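import Summits.KontsevichZagierPeriods.KontsevichZagierPeriods.Theses.HurwitzMicroSectors
import Summits.KontsevichZagierPeriods.KontsevichZagierPeriods.Theorems.HurwitzMicroSectorsNormalFormPrinciplePiBoxTransfer
import Summits.KontsevichZagierPeriods.KontsevichZagierPeriods.Theorems.HurwitzMicroSectorsNormalFormPrincipleVariants2265

/-! TTRL-lite variant V2269 of stmt-KontsevichZagierPeriods-3869

Variant V2269 = `stub_boxRigidity` (the leaf `BoxRigidity` of `NormalFormPrinciple`: two BOX-RATIONAL
representations — domain the open unit box, integrand `p/q` over `ℚ`, `q ≠ 0` on the box — with equal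
values are KZ-equivalent) under the move `fix_nat:m=4; bound_nat:m'≤3` (a box-rational representation
on `(0,1)⁴` against one on `(0,1)^{m'}`, `m' ≤ 3`). Verdict of the attempt seat: **open** — this file is
the exact-strength certificate, not a proof of the variant:

* `stub_boxRigidity_var2269_iff_boxVanishing_four`: V2269 ⟺ **BoxVanishing(4)** — every box-rational
  representation on `(0,1)⁴` of value `0` is a relation (⇒: specialise `m' := 2` and compare with the
  zero representation on the square, `boxVanishing_four_of_stub_boxRigidity_var2265`; ⇐: pad the small
  side to the `4`-box and subtract on the common box, `boxRigidityLe_four_of_boxVanishing_four_var2265`);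
* `stub_boxRigidity_var2269_iff_var2268` / `_iff_var2265`: hence V2269 is LITERALLY EQUIVALENT to the
  sibling variants V2268 (`m' = 3` frozen) and V2265 (`m' = 2` frozen): the bound `m' ≤ 3` is idle once
  the larger dimension is frozen to `4`;
* `stub_boxRigidity_var2269_iff_boxRigidityLe_four` / `_iff_var2272` / `_iff_var2270`: V2269 ⟺
  BoxRigidity with BOTH dimensions `≤ 4` (Conjecture 1 of Kontsevich–Zagier for every pair of rational
  integrands on the boxes `(0,1)^{≤ 4}`) ⟺ the sibling shapes `m = 4, m' ≤ 4` and `m ≤ 4, m' ≤ 3`;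
* `stub_boxRigidity_var2269_of_statement` / `_of_parent`: Summit ⇒ parent leaf ⇒ V2269, so the variant
  is not refutable short of refuting Conjecture 1 for the tree's calculus (no invariant of `KZ.relations`
  finer than `eval` is known, and `eval` cannot separate two representations with equal values);
* what it contains, unconditionally: BoxVanishing in every dimension `≤ 4`
  (`boxVanishingLe_four_of_stub_boxRigidity_var2269`), the cube fragment V2242
  (`stub_boxRigidity_var2242_of_var2269`, e.g. Euler's `ζ(2,1) = ζ(3)`), and on its own shape the
  weight-four Hurwitz sectors of the `4`-box against any box-rational representation of dimension `≤ 3`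
  (`sectorFourLe_of_stub_boxRigidity_var2269`): for every `a b : ℚ` the instance
  "`β(4) = a + bζ(3) ⇒ [1/(1 + x²y²z²w²)]_{□⁴} ∼ [a + b/(1 − xyz)]_{□³}`" is decided today by no theorem
  (the `ℚ`-independence of `1, ζ(3), β(4)` is open and no chain of moves is known); inside
  BoxVanishing(4) itself sit TRUE weight-four identities with no chain of moves in the tree, e.g.
  Euler's `ζ(3,1) = ζ(4)/4`. This is the residual goal.
(Contrast: both dimensions `≤ 1` is the theorem `boxRigidity_of_le_one`, by Baker; dimension `2` is the
first open one, and V2269 sits two rungs above it.)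
Source: M. Kontsevich, D. Zagier, *Periods* (2001), §1.2 Conjecture 1. Pure proof file, no definitions. -/

-- `Summit.<Summit>.<Problem>` is the tree's mandated summit-side namespace (CONVENTIONS §2); for this
-- single-conjunct summit the two coincide, so the duplicate is deliberate.
set_option linter.dupNamespace false

noncomputable section

namespace Summit.KontsevichZagierPeriods.KontsevichZagierPeriods.Theorems

open MeasureTheory Set
open Literature.NumberTheory.Transcendental Literature.NumberTheory.Transcendental.KZ
open Summit.KontsevichZagierPeriods.KontsevichZagierPeriods.Theses.HurwitzMicroSectors
open Summit.KontsevichZagierPeriods.HurwitzMicroSectors.NormalFormPrinciple.PiBox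
open Summit.KontsevichZagierPeriods.HurwitzMicroSectors.NormalFormPrinciple.PiBox.stub_boxCombineAux
  (pad_le)

/-! ## V2269 is BoxVanishing in dimension 4 -/

/-- **V2269 ⇒ V2268**: the frozen instance `m' = 3` of the bounded variant.
[cite: KontsevichZagier2001, §1.2 Conjecture 1] -/
theorem stub_boxRigidity_var2268_of_var2269
    (h : ∀ (m' : ℕ) (N : IntegralRep 4) (N' : IntegralRep m'), m' ≤ 3 → N.domain = {x | ∀ i, x i ∈ Set.Ioo (0:ℝ) 1} → N.IsRational → N'.domain = {x | ∀ i, x i ∈ Set.Ioo (0:ℝ) 1} → N'.IsRational → N.value = N'.value → Equivalent N N') :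
    ∀ (N : IntegralRep 4) (N' : IntegralRep 3), N.domain = {x | ∀ i, x i ∈ Set.Ioo (0:ℝ) 1} → N.IsRational → N'.domain = {x | ∀ i, x i ∈ Set.Ioo (0:ℝ) 1} → N'.IsRational → N.value = N'.value → Equivalent N N' :=
  fun N N' => h 3 N N' le_rfl

/-- **V2269 ⇒ V2265**: the instance `m' = 2` of the bounded variant.
[cite: KontsevichZagier2001, §1.2 Conjecture 1] -/
theorem stub_boxRigidity_var2265_of_var2269
    (h : ∀ (m' : ℕ) (N : IntegralRep 4) (N' : IntegralRep m'), m' ≤ 3 → N.domain = {x | ∀ i, x i ∈ Set.Ioo (0:ℝ) 1} → N.IsRational → N'.domain = {x | ∀ i, x i ∈ Set.Ioo (0:ℝ) 1} → N'.IsRational → N.value = N'.value → Equivalent N N') :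
    ∀ (N : IntegralRep 4) (N' : IntegralRep 2), N.domain = {x | ∀ i, x i ∈ Set.Ioo (0:ℝ) 1} → N.IsRational → N'.domain = {x | ∀ i, x i ∈ Set.Ioo (0:ℝ) 1} → N'.IsRational → N.value = N'.value → Equivalent N N' :=
  fun N N' => h 2 N N' (by norm_num)

/-- **V2269 ⇒ BoxVanishing(4)**: a box-rational `N : IntegralRep 4` of value `0` is a relation
(through V2265: compare with the zero representation on the open unit square).
[cite: KontsevichZagier2001, §1.2 Conjecture 1] -/
theorem boxVanishing_four_of_stub_boxRigidity_var2269
    (h : ∀ (m' : ℕ) (N : IntegralRep 4) (N' : IntegralRep m'), m' ≤ 3 → N.domain = {x | ∀ i, x i ∈ Set.Ioo (0:ℝ) 1} → N.IsRational → N'.domain = {x | ∀ i, x i ∈ Set.Ioo (0:ℝ) 1} → N'.IsRational → N.value = N'.value → Equivalent N N')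
    (N : IntegralRep 4) (hNd : N.domain = {x | ∀ i, x i ∈ Set.Ioo (0:ℝ) 1}) (hNr : N.IsRational)
    (hv : N.value = 0) : of N ∈ relations :=
  boxVanishing_four_of_stub_boxRigidity_var2265 (stub_boxRigidity_var2265_of_var2269 h) N hNd hNr hv

/-- **BoxVanishing(4) ⇒ V2269** (instances `m = 4`, `m' ≤ 3 ≤ 4` of the padding lemma
`boxRigidityLe_four_of_boxVanishing_four_var2265`: pad the small side to the `4`-box, subtract on the
common box, the difference has value `0`). [cite: KontsevichZagier2001, §1.2 Conjecture 1] -/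
theorem stub_boxRigidity_var2269_of_boxVanishing_four
    (hvan : ∀ N : IntegralRep 4, N.domain = {x | ∀ i, x i ∈ Set.Ioo (0:ℝ) 1} → N.IsRational →
      N.value = 0 → of N ∈ relations) :
    ∀ (m' : ℕ) (N : IntegralRep 4) (N' : IntegralRep m'), m' ≤ 3 → N.domain = {x | ∀ i, x i ∈ Set.Ioo (0:ℝ) 1} → N.IsRational → N'.domain = {x | ∀ i, x i ∈ Set.Ioo (0:ℝ) 1} → N'.IsRational → N.value = N'.value → Equivalent N N' :=
  fun _ N N' hm' =>
    boxRigidityLe_four_of_boxVanishing_four_var2265 hvan le_rfl (hm'.trans (by norm_num)) N N'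

/-- **V2269 ⟺ BoxVanishing(4)**: the instance `m = 4, m' ≤ 3` of `stub_boxRigidity` is exactly the
statement that every box-rational representation on `(0,1)⁴` of value `0` is a relation.
[cite: KontsevichZagier2001, §1.2 Conjecture 1] -/
theorem stub_boxRigidity_var2269_iff_boxVanishing_four :
    (∀ (m' : ℕ) (N : IntegralRep 4) (N' : IntegralRep m'), m' ≤ 3 → N.domain = {x | ∀ i, x i ∈ Set.Ioo (0:ℝ) 1} → N.IsRational → N'.domain = {x | ∀ i, x i ∈ Set.Ioo (0:ℝ) 1} → N'.IsRational → N.value = N'.value → Equivalent N N') ↔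
    (∀ N : IntegralRep 4, N.domain = {x | ∀ i, x i ∈ Set.Ioo (0:ℝ) 1} → N.IsRational →
      N.value = 0 → of N ∈ relations) :=
  ⟨boxVanishing_four_of_stub_boxRigidity_var2269, stub_boxRigidity_var2269_of_boxVanishing_four⟩

/-- **V2269 ⟺ V2268**: bounding `m' ≤ 3` or freezing `m' = 3` gives literally equivalent statements
(both are BoxVanishing(4)). [cite: KontsevichZagier2001, §1.2 Conjecture 1] -/
theorem stub_boxRigidity_var2269_iff_var2268 :
    (∀ (m' : ℕ) (N : IntegralRep 4) (N' : IntegralRep m'), m' ≤ 3 → N.domain = {x | ∀ i, x i ∈ Set.Ioo (0:ℝ) 1} → N.IsRational → N'.domain = {x | ∀ i, x i ∈ Set.Ioo (0:ℝ) 1} → N'.IsRational → N.value = N'.value → Equivalent N N') ↔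
    (∀ (N : IntegralRep 4) (N' : IntegralRep 3), N.domain = {x | ∀ i, x i ∈ Set.Ioo (0:ℝ) 1} → N.IsRational → N'.domain = {x | ∀ i, x i ∈ Set.Ioo (0:ℝ) 1} → N'.IsRational → N.value = N'.value → Equivalent N N') :=
  ⟨stub_boxRigidity_var2268_of_var2269, fun h => stub_boxRigidity_var2269_of_boxVanishing_four fun N hNd hNr hv => by
    -- V2268 ⇒ BoxVanishing(4): compare with the zero representation on the open unit cube
    obtain ⟨Z, hZd, hZi⟩ := exists_zeroRep (isSemialgebraic_box 3)
    have hZ : of Z ∈ relations := of_mem_relations_of_eqOn_zero Z (by simp [hZi, EqOn])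
    have hZv : Z.value = 0 := by simp [IntegralRep.value, hZi]
    have hZr : Z.IsRational := ⟨0, 1, fun x _ => by simp, fun x _ => by simp [hZi]⟩
    have h' : of N - of Z ∈ relations := h N Z hNd hNr hZd hZr (by rw [hv, hZv])
    simpa using relations.add_mem h' hZ⟩

/-- **V2269 ⟺ V2265**: the same with the sibling `m = 4, m' = 2`.
[cite: KontsevichZagier2001, §1.2 Conjecture 1] -/
theorem stub_boxRigidity_var2269_iff_var2265 :
    (∀ (m' : ℕ) (N : IntegralRep 4) (N' : IntegralRep m'), m' ≤ 3 → N.domain = {x | ∀ i, x i ∈ Set.Ioo (0:ℝ) 1} → N.IsRational → N'.domain = {x | ∀ i, x i ∈ Set.Ioo (0:ℝ) 1} → N'.IsRational → N.value = N'.value → Equivalent N N') ↔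
    (∀ (N : IntegralRep 4) (N' : IntegralRep 2), N.domain = {x | ∀ i, x i ∈ Set.Ioo (0:ℝ) 1} → N.IsRational → N'.domain = {x | ∀ i, x i ∈ Set.Ioo (0:ℝ) 1} → N'.IsRational → N.value = N'.value → Equivalent N N') :=
  stub_boxRigidity_var2269_iff_boxVanishing_four.trans stub_boxRigidity_var2265_iff_boxVanishing_four.symm

/-- **V2269 ⟺ BoxRigidity with both dimensions `≤ 4`** (the honest strength of the variant: Conjecture 1
for all pairs of rational integrands on the open unit boxes of dimension at most `4`; the bound `m' ≤ 3`
may be relaxed to `m' ≤ 4` and the frozen `m = 4` to `m ≤ 4`). [cite: KontsevichZagier2001, §1.2 Conjecture 1] -/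
theorem stub_boxRigidity_var2269_iff_boxRigidityLe_four :
    (∀ (m' : ℕ) (N : IntegralRep 4) (N' : IntegralRep m'), m' ≤ 3 → N.domain = {x | ∀ i, x i ∈ Set.Ioo (0:ℝ) 1} → N.IsRational → N'.domain = {x | ∀ i, x i ∈ Set.Ioo (0:ℝ) 1} → N'.IsRational → N.value = N'.value → Equivalent N N') ↔
    (∀ (m m' : ℕ) (N : IntegralRep m) (N' : IntegralRep m'), m ≤ 4 → m' ≤ 4 →
      N.domain = {x | ∀ i, x i ∈ Set.Ioo (0:ℝ) 1} → N.IsRational →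
      N'.domain = {x | ∀ i, x i ∈ Set.Ioo (0:ℝ) 1} → N'.IsRational →
      N.value = N'.value → Equivalent N N') :=
  ⟨fun h _ _ N N' hm hm' => boxRigidityLe_four_of_boxVanishing_four_var2265
      (boxVanishing_four_of_stub_boxRigidity_var2269 h) hm hm' N N',
    fun h m' N N' hm' => h 4 m' N N' le_rfl (hm'.trans (by norm_num))⟩

/-- **V2269 ⟺ V2272** (the sibling `fix_nat:m=4; bound_nat:m'≤4`): relaxing the idle bound `m' ≤ 3` to
`m' ≤ 4` changes nothing. [cite: KontsevichZagier2001, §1.2 Conjecture 1] -/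
theorem stub_boxRigidity_var2269_iff_var2272 :
    (∀ (m' : ℕ) (N : IntegralRep 4) (N' : IntegralRep m'), m' ≤ 3 → N.domain = {x | ∀ i, x i ∈ Set.Ioo (0:ℝ) 1} → N.IsRational → N'.domain = {x | ∀ i, x i ∈ Set.Ioo (0:ℝ) 1} → N'.IsRational → N.value = N'.value → Equivalent N N') ↔
    (∀ (m' : ℕ) (N : IntegralRep 4) (N' : IntegralRep m'), m' ≤ 4 → N.domain = {x | ∀ i, x i ∈ Set.Ioo (0:ℝ) 1} → N.IsRational → N'.domain = {x | ∀ i, x i ∈ Set.Ioo (0:ℝ) 1} → N'.IsRational → N.value = N'.value → Equivalent N N') :=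
  ⟨fun h m' N N' hm' => stub_boxRigidity_var2269_iff_boxRigidityLe_four.1 h 4 m' N N' le_rfl hm',
    fun h m' N N' hm' => h m' N N' (hm'.trans (by norm_num))⟩

/-- **V2269 ⟺ V2270** (the sibling `bound_nat:m≤4; bound_nat:m'≤3`, hypotheses in the matchmaker's
order `m' ≤ 3 → m ≤ 4`): relaxing the frozen `m = 4` to `m ≤ 4` changes nothing (padding).
[cite: KontsevichZagier2001, §1.2 Conjecture 1] -/
theorem stub_boxRigidity_var2269_iff_var2270 :
    (∀ (m' : ℕ) (N : IntegralRep 4) (N' : IntegralRep m'), m' ≤ 3 → N.domain = {x | ∀ i, x i ∈ Set.Ioo (0:ℝ) 1} → N.IsRational → N'.domain = {x | ∀ i, x i ∈ Set.Ioo (0:ℝ) 1} → N'.IsRational → N.value = N'.value → Equivalent N N') ↔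
    (∀ (m m' : ℕ) (N : IntegralRep m) (N' : IntegralRep m'), m' ≤ 3 → m ≤ 4 → N.domain = {x | ∀ i, x i ∈ Set.Ioo (0:ℝ) 1} → N.IsRational → N'.domain = {x | ∀ i, x i ∈ Set.Ioo (0:ℝ) 1} → N'.IsRational → N.value = N'.value → Equivalent N N') :=
  ⟨fun h m m' N N' hm' hm =>
      stub_boxRigidity_var2269_iff_boxRigidityLe_four.1 h m m' N N' hm (hm'.trans (by norm_num)),
    fun h m' N N' hm' => h 4 m' N N' hm' le_rfl⟩

/-- **V2269 ⇒ BoxVanishing in every dimension `≤ 4`** (pad to the `4`-box, `pad_le`; the value is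
kept by soundness). [cite: KontsevichZagier2001, §1.2 Conjecture 1] -/
theorem boxVanishingLe_four_of_stub_boxRigidity_var2269
    (h : ∀ (m' : ℕ) (N : IntegralRep 4) (N' : IntegralRep m'), m' ≤ 3 → N.domain = {x | ∀ i, x i ∈ Set.Ioo (0:ℝ) 1} → N.IsRational → N'.domain = {x | ∀ i, x i ∈ Set.Ioo (0:ℝ) 1} → N'.IsRational → N.value = N'.value → Equivalent N N')
    {m : ℕ} (hm : m ≤ 4) (N : IntegralRep m) (hNd : N.domain = {x | ∀ i, x i ∈ Set.Ioo (0:ℝ) 1})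
    (hNr : N.IsRational) (hv : N.value = 0) : of N ∈ relations :=
  boxVanishingLe_four_of_stub_boxRigidity_var2265 (stub_boxRigidity_var2265_of_var2269 h) hm N hNd hNr hv

/-- **Parent ⇒ V2269** (the variant is a specialisation of the leaf `stub_boxRigidity`; the converse is
not claimed — the parent is BoxVanishing in ALL dimensions). [cite: KontsevichZagier2001, §1.2 Conjecture 1] -/
theorem stub_boxRigidity_var2269_of_parent
    (h : ∀ (m m' : ℕ) (N : IntegralRep m) (N' : IntegralRep m'), N.domain = {x | ∀ i, x i ∈ Set.Ioo (0:ℝ) 1} → N.IsRational → N'.domain = {x | ∀ i, x i ∈ Set.Ioo (0:ℝ) 1} → N'.IsRational → N.value = N'.value → Equivalent N N') :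
    ∀ (m' : ℕ) (N : IntegralRep 4) (N' : IntegralRep m'), m' ≤ 3 → N.domain = {x | ∀ i, x i ∈ Set.Ioo (0:ℝ) 1} → N.IsRational → N'.domain = {x | ∀ i, x i ∈ Set.Ioo (0:ℝ) 1} → N'.IsRational → N.value = N'.value → Equivalent N N' :=
  fun m' N N' _ => h 4 m' N N'

/-- **`KontsevichZagierPeriods ⇒ V2269`**: the variant is a special case of Conjecture 1 for the tree's
calculus — a refutation of the variant would refute the Summit. [cite: KontsevichZagier2001, §1.2 Conjecture 1] -/
theorem stub_boxRigidity_var2269_of_statement (h : _root_.KontsevichZagierPeriods) :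
    ∀ (m' : ℕ) (N : IntegralRep 4) (N' : IntegralRep m'), m' ≤ 3 → N.domain = {x | ∀ i, x i ∈ Set.Ioo (0:ℝ) 1} → N.IsRational → N'.domain = {x | ∀ i, x i ∈ Set.Ioo (0:ℝ) 1} → N'.IsRational → N.value = N'.value → Equivalent N N' :=
  stub_boxRigidity_var2269_of_parent (leaves_of_statement h).1

/-! ## What the variant contains, unconditionally -/

/-- **V2269 ⇒ V2242** (the cube fragment `m = m' = 3`, i.e. BoxVanishing(3)), one rung down by padding:
e.g. Euler's `ζ(2,1) = ζ(3)` as `[xy/((1 − xy)(1 − xyz))]_{□³} ∼ [1/(1 − xyz)]_{□³}`.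
[cite: KontsevichZagier2001, §1.2 Conjecture 1] -/
theorem stub_boxRigidity_var2242_of_var2269
    (h : ∀ (m' : ℕ) (N : IntegralRep 4) (N' : IntegralRep m'), m' ≤ 3 → N.domain = {x | ∀ i, x i ∈ Set.Ioo (0:ℝ) 1} → N.IsRational → N'.domain = {x | ∀ i, x i ∈ Set.Ioo (0:ℝ) 1} → N'.IsRational → N.value = N'.value → Equivalent N N') :
    ∀ (N : IntegralRep 3) (N' : IntegralRep 3), N.domain = {x | ∀ i, x i ∈ Set.Ioo (0:ℝ) 1} → N.IsRational → N'.domain = {x | ∀ i, x i ∈ Set.Ioo (0:ℝ) 1} → N'.IsRational → N.value = N'.value → Equivalent N N' :=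
  fun N N' => boxRigidityLe_four_of_boxVanishing_four_var2265
    (boxVanishing_four_of_stub_boxRigidity_var2269 h) (by norm_num) (by norm_num) N N'

/-- **V2269 on its own shape, unconditionally: weight-four Hurwitz sectors of the `4`-box against any
box-rational representation of dimension `≤ 3`.** A representation on `(0,1)⁴` with integrand
`P(xyzw)/(1 − (xyzw)ᴸ)` (`L ≠ 0`; values: `ℚ`-combinations of `1` and WEIGHT-FOUR level-`L` Hurwitz
values, e.g. `ζ(4) = ∫ dxdydzdw/(1 − xyzw)`, `β(4) = ∫ dxdydzdw/(1 + x²y²z²w²)`) and ANY box-rational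
representation on `(0,1)^{m'}`, `m' ≤ 3` (values: `1`, `log 2`, `π²/6`, `G`, `ζ(3)`, `β(3) = π³/32`, …)
with equal values are KZ-equivalent. Instance: for every `a b : ℚ`,
"`β(4) = a + bζ(3) ⇒ [1/(1 + x²y²z²w²)]_{□⁴} ∼ [a + b/(1 − xyz)]_{□³}`" — decided today by no theorem.
[cite: KontsevichZagier2001, §1.2 Conjecture 1] -/
theorem sectorFourLe_of_stub_boxRigidity_var2269
    (h : ∀ (m' : ℕ) (N : IntegralRep 4) (N' : IntegralRep m'), m' ≤ 3 → N.domain = {x | ∀ i, x i ∈ Set.Ioo (0:ℝ) 1} → N.IsRational → N'.domain = {x | ∀ i, x i ∈ Set.Ioo (0:ℝ) 1} → N'.IsRational → N.value = N'.value → Equivalent N N')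
    (L : ℕ) (hL : L ≠ 0) {m' : ℕ} (hm' : m' ≤ 3) :
    ∀ (r : IntegralRep 4) (r' : IntegralRep m') (P : Polynomial ℚ),
      r.domain = {x | ∀ i, x i ∈ Set.Ioo (0:ℝ) 1} →
      EqOn r.integrand
        (fun x => Polynomial.aeval (x 0 * x 1 * x 2 * x 3) P / (1 - (x 0 * x 1 * x 2 * x 3) ^ L)) r.domain →
      r'.domain = {x | ∀ i, x i ∈ Set.Ioo (0:ℝ) 1} → r'.IsRational →
      r.value = r'.value → Equivalent r r' :=
  fun r r' P hr hP hr' hr'r hv =>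
    h m' r r' hm' hr (isRational_of_sectorFour_var2265 L hL r P hr hP) hr' hr'r hv

end Summit.KontsevichZagierPeriods.KontsevichZagierPeriods.Theorems
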